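import Summits.Ventures.PercRepro.GenQHypAddTwoD

/-!
# PercRepro — the trace layer's «trace + two points» shape is the same functional one level down (night-4, gen 10)

The level-`(q + 2)` trace sum at type `t` on a rank-`(q + 1)` set `H` (the summand `(q + 4 − t)/(2 + m(B)) −
Φ·dem`, `Φ = (q + 4)/(q + 3)`, over `B ∈ R_{q+1}(H)`) for `H = K ∪ {b, b′}` with `ρ(K) = q`, `b, b′ ∉ cl(K)`:
`R_{q+1}(H)` is the four-family decomposition of `GenQHypAddTwoC` (`Rq_succ_eq_union` with `τ := K`), the coloop
counts are `≤ m(K′) + 1`, `≤ m(K′) + 1`, `≤ m(K′)`, `≤ m(K″) + 2` and the demands are the complement shapes of part C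
— so the trace sum dominates the explicit functional `traceHypAddTwoProfile M K b b′ q t` of the rank-`q` trace `K`
(`traceSum_hyp_add_two_ge_profile`): the (β₂) piece of the TYPE layer (`hypAddTwoProfile`) with the trace weights
`1/(2+m), 1/(2+m), 1/(1+m), 1/(3+m)` shifted to `1/(3+m), 1/(3+m), 1/(2+m), 1/(4+m)`.  With
`mTr_ne_zero_of_sdiff_card_one_gen` and the coloop argument of `GenQNearEndPiecesGenB`, the trace layer's near end at
branch depth `2` is exactly «branch certificate ∧ this functional ≥ 0» (`traceSum_succ_of_two_pieces`); at `(9, 7)`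
(`q = 5`, type `6`) this is the shape «rank-`5` trace + 2 points» of `TraceSixResidue`.
-/
namespace PercRepro.GenQ

open Finset ThmH SixFour

variable {α : Type*} [DecidableEq α] {M : Matroid α} [M.Finite]

section TraceHypAddTwo

variable {τ : Finset α} {a a' : α} {q t : ℕ}

/-- The summand of the level-`(q + 2)` trace sum at type `t` on `H`: `(q + 4 − t)/(2 + m(B)) − Φ·dem`. -/
noncomputable def tfun (M : Matroid α) [M.Finite] (H : Finset α) (q t : ℕ) (B : Finset α) : ℚ :=
  (((q + 1 + 1 : ℕ) : ℚ) + 2 - t) * (1 / (2 + (mTr M B : ℚ))) -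
    ((((q + 1 + 1 : ℕ) : ℚ) + 2) / (((q + 1 + 1 : ℕ) : ℚ) + 1)) * dem M H t B

/-- **The trace-layer profile functional** of the rank-`q` trace `τ` with the two points `a, a′`: the four families'
contributions to the level-`(q + 2)` trace sum of `τ ∪ {a, a′}` at type `t`, written on `τ`. -/
noncomputable def traceHypAddTwoProfile (M : Matroid α) [M.Finite] (τ : Finset α) (a a' : α) (q t : ℕ) : ℚ :=
  (∑ B ∈ Rq M τ q,
      ((((q + 1 + 1 : ℕ) : ℚ) + 2 - t) * (2 * (1 / (3 + (mTr M B : ℚ))) + 1 / (2 + (mTr M B : ℚ))) -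
        ((((q + 1 + 1 : ℕ) : ℚ) + 2) / (((q + 1 + 1 : ℕ) : ℚ) + 1)) *
          (2 * (if M.eRk ((τ \ B : Finset α) : Set α) + 1 + 1 ≤ (t : ℕ∞) then (0 : ℚ) else 1) +
            dem M τ t B))) +
    ∑ B ∈ RqPred M τ a a' q,
      ((((q + 1 + 1 : ℕ) : ℚ) + 2 - t) * (1 / (4 + (mTr M B : ℚ))) -
        ((((q + 1 + 1 : ℕ) : ℚ) + 2) / (((q + 1 + 1 : ℕ) : ℚ) + 1)) * dem M τ t B)

/-- The coefficient `(q + 4 − t)` is nonnegative for `t ≤ q + 2`. -/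
theorem tcoeff_nonneg (ht : t ≤ q + 2) : (0 : ℚ) ≤ ((q + 1 + 1 : ℕ) : ℚ) + 2 - t := by
  have : (t : ℚ) ≤ ((q + 1 + 1 : ℕ) : ℚ) := by exact_mod_cast ht
  linarith

/-- Family 1: `tfun (B ∪ {a})` against the profile term. -/
theorem tfun_insert_left_ge (ha' : a' ∈ gr M) (hne : a ≠ a') (haτ : a ∉ τ) (ha'τ : a' ∉ τ)
    (ha'cl : a' ∉ M.closure (τ : Set α)) (ht : t ≤ q + 2) {B : Finset α} (hB : B ∈ Rq M τ q) :
    (((q + 1 + 1 : ℕ) : ℚ) + 2 - t) * (1 / (3 + (mTr M B : ℚ))) -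
        ((((q + 1 + 1 : ℕ) : ℚ) + 2) / (((q + 1 + 1 : ℕ) : ℚ) + 1)) *
          (if M.eRk ((τ \ B : Finset α) : Set α) + 1 + 1 ≤ (t : ℕ∞) then (0 : ℚ) else 1) ≤
      tfun M (insert a (insert a' τ)) q t (insert a B) := by
  have hBτ := (mem_Rq.1 hB).1
  unfold tfun dem
  rw [sdiff_insert_left hne haτ ha'τ hBτ, eRk_insert_sub ha' ha'cl Finset.sdiff_subset]
  apply sub_le_sub_right
  apply mul_le_mul_of_nonneg_left _ (tcoeff_nonneg ht)
  apply one_div_le_one_div_of_le (by positivity)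
  have := mTr_insert_le (M := M) B a
  have h' : (mTr M (insert a B) : ℚ) ≤ mTr M B + 1 := by exact_mod_cast this
  linarith

/-- Family 2: `tfun (B ∪ {a′})` against the profile term. -/
theorem tfun_insert_right_ge (ha : a ∈ gr M) (hne : a ≠ a') (haτ : a ∉ τ) (ha'τ : a' ∉ τ)
    (hacl : a ∉ M.closure (τ : Set α)) (ht : t ≤ q + 2) {B : Finset α} (hB : B ∈ Rq M τ q) :
    (((q + 1 + 1 : ℕ) : ℚ) + 2 - t) * (1 / (3 + (mTr M B : ℚ))) -
        ((((q + 1 + 1 : ℕ) : ℚ) + 2) / (((q + 1 + 1 : ℕ) : ℚ) + 1)) *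
          (if M.eRk ((τ \ B : Finset α) : Set α) + 1 + 1 ≤ (t : ℕ∞) then (0 : ℚ) else 1) ≤
      tfun M (insert a (insert a' τ)) q t (insert a' B) := by
  have hBτ := (mem_Rq.1 hB).1
  unfold tfun dem
  rw [sdiff_insert_right hne haτ ha'τ hBτ, eRk_insert_sub ha hacl Finset.sdiff_subset]
  apply sub_le_sub_right
  apply mul_le_mul_of_nonneg_left _ (tcoeff_nonneg ht)
  apply one_div_le_one_div_of_le (by positivity)
  have := mTr_insert_le (M := M) B a'
  have h' : (mTr M (insert a' B) : ℚ) ≤ mTr M B + 1 := by exact_mod_cast this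
  linarith

/-- Family 3: `tfun (B ∪ {a, a′})` for `B ∈ R_q(τ)` against the profile term. -/
theorem tfun_insert_insert_ge (ha : a ∈ gr M) (ha' : a' ∈ gr M) (hne : a ≠ a') (haτ : a ∉ τ) (ha'τ : a' ∉ τ)
    (hacl : a ∉ M.closure (τ : Set α)) (ha'cl : a' ∉ M.closure (τ : Set α))
    (hrG : M.eRk ((insert a (insert a' τ) : Finset α) : Set α) = (q : ℕ∞) + 1) (ht : t ≤ q + 2)
    {B : Finset α} (hB : B ∈ Rq M τ q) :
    (((q + 1 + 1 : ℕ) : ℚ) + 2 - t) * (1 / (2 + (mTr M B : ℚ))) -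
        ((((q + 1 + 1 : ℕ) : ℚ) + 2) / (((q + 1 + 1 : ℕ) : ℚ) + 1)) * dem M τ t B ≤
      tfun M (insert a (insert a' τ)) q t (insert a (insert a' B)) := by
  have hBτ := (mem_Rq.1 hB).1
  have hBr := (mem_Rq.1 hB).2
  unfold tfun dem
  rw [sdiff_insert_insert haτ ha'τ B]
  apply sub_le_sub_right
  apply mul_le_mul_of_nonneg_left _ (tcoeff_nonneg ht)
  apply one_div_le_one_div_of_le (by positivity)
  have hr₃ : M.eRk ((insert a (insert a' B) : Finset α) : Set α) = (q : ℕ∞) + 1 := by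
    have := (mem_Rq.1 (insert_insert_mem_Rq ha' ha'cl hrG hB)).2
    rw [this, Nat.cast_add_one]
  have hm := mTr_insert_insert_le (M := M) ha ha' hne (fun h => haτ (hBτ h)) (fun h => ha'τ (hBτ h))
    (by rw [hr₃, eRk_insert_sub ha' ha'cl hBτ, hBr])
    (by rw [hr₃, eRk_insert_sub ha hacl hBτ, hBr])
  have h' : (mTr M (insert a (insert a' B)) : ℚ) ≤ mTr M B := by exact_mod_cast hm
  linarith

/-- Family 4: `tfun (B ∪ {a, a′})` for `B ∈ RqPred` against the profile term. -/
theorem tfun_insert_insert_pred_ge (haτ : a ∉ τ) (ha'τ : a' ∉ τ) (ht : t ≤ q + 2) {B : Finset α}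
    (_hB : B ∈ RqPred M τ a a' q) :
    (((q + 1 + 1 : ℕ) : ℚ) + 2 - t) * (1 / (4 + (mTr M B : ℚ))) -
        ((((q + 1 + 1 : ℕ) : ℚ) + 2) / (((q + 1 + 1 : ℕ) : ℚ) + 1)) * dem M τ t B ≤
      tfun M (insert a (insert a' τ)) q t (insert a (insert a' B)) := by
  unfold tfun dem
  rw [sdiff_insert_insert haτ ha'τ B]
  apply sub_le_sub_right
  apply mul_le_mul_of_nonneg_left _ (tcoeff_nonneg ht)
  apply one_div_le_one_div_of_le (by positivity)
  have h1 := mTr_insert_le (M := M) (insert a' B) a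
  have h2 := mTr_insert_le (M := M) B a'
  have h1' : (mTr M (insert a (insert a' B)) : ℚ) ≤ mTr M (insert a' B) + 1 := by exact_mod_cast h1
  have h2' : (mTr M (insert a' B) : ℚ) ≤ mTr M B + 1 := by exact_mod_cast h2
  linarith

/-- **«Trace + two points» at the trace layer, by the same counting**: for `H = τ ∪ {a, a′}` with `ρ(τ) = q ≥ 1`,
`a, a′ ∉ cl(τ)`, `ρ(H) = q + 1`, and every type `t ≤ q + 2`, the level-`(q + 2)` trace sum of `H` dominates the
trace-layer profile functional of `τ`. -/
theorem traceSum_hyp_add_two_ge_profile (ha : a ∈ gr M) (ha' : a' ∈ gr M) (hne : a ≠ a') (haτ : a ∉ τ)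
    (ha'τ : a' ∉ τ) (hacl : a ∉ M.closure (τ : Set α)) (ha'cl : a' ∉ M.closure (τ : Set α))
    (hrτ : M.eRk (τ : Set α) = (q : ℕ∞)) (hrG : M.eRk ((insert a (insert a' τ) : Finset α) : Set α) = (q : ℕ∞) + 1)
    (hq : 1 ≤ q) (ht : t ≤ q + 2) :
    traceHypAddTwoProfile M τ a a' q t ≤
      ∑ B ∈ Rq M (insert a (insert a' τ)) (q + 1),
        ((((q + 1 + 1 : ℕ) : ℚ) + 2 - t) * (1 / (2 + (mTr M B : ℚ))) -
          ((((q + 1 + 1 : ℕ) : ℚ) + 2) / (((q + 1 + 1 : ℕ) : ℚ) + 1)) * dem M (insert a (insert a' τ)) t B) := by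
  have hsum : ∑ B ∈ Rq M (insert a (insert a' τ)) (q + 1),
      ((((q + 1 + 1 : ℕ) : ℚ) + 2 - t) * (1 / (2 + (mTr M B : ℚ))) -
        ((((q + 1 + 1 : ℕ) : ℚ) + 2) / (((q + 1 + 1 : ℕ) : ℚ) + 1)) * dem M (insert a (insert a' τ)) t B) =
      ∑ B ∈ Rq M (insert a (insert a' τ)) (q + 1), tfun M (insert a (insert a' τ)) q t B := rfl
  rw [hsum, Rq_succ_eq_union ha ha' hne hacl ha'cl hrτ hrG hq]
  rw [Finset.sum_union (Finset.disjoint_union_left.2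
      ⟨disjoint_im₁₂_im hne haτ ha'τ _, disjoint_im₃_im₄ hne haτ ha'τ hq⟩),
    Finset.sum_union (disjoint_im₁₂_im hne haτ ha'τ _), Finset.sum_union (disjoint_im₁_im₂ hne haτ)]
  rw [Finset.sum_image (fun B hB B' hB' h => insert_inj_of_subset haτ (mem_Rq.1 hB).1 (mem_Rq.1 hB').1 h),
    Finset.sum_image (fun B hB B' hB' h => insert_inj_of_subset ha'τ (mem_Rq.1 hB).1 (mem_Rq.1 hB').1 h),
    Finset.sum_image (fun B hB B' hB' h =>
      insert_insert_inj_of_subset hne haτ ha'τ (mem_Rq.1 hB).1 (mem_Rq.1 hB').1 h),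
    Finset.sum_image (fun B hB B' hB' h =>
      insert_insert_inj_of_subset hne haτ ha'τ (subset_of_mem_RqPred hB) (subset_of_mem_RqPred hB') h)]
  unfold traceHypAddTwoProfile
  have h1 := Finset.sum_le_sum (fun B hB => tfun_insert_left_ge (M := M) ha' hne haτ ha'τ ha'cl ht hB)
  have h2 := Finset.sum_le_sum (fun B hB => tfun_insert_right_ge (M := M) ha hne haτ ha'τ hacl ht hB)
  have h3 := Finset.sum_le_sum (fun B hB => tfun_insert_insert_ge (M := M) ha ha' hne haτ ha'τ hacl ha'cl hrG ht hB)
  have h4 := Finset.sum_le_sum (fun B hB => tfun_insert_insert_pred_ge (M := M) haτ ha'τ ht hB)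
  have e : ∑ B ∈ Rq M τ q,
      ((((q + 1 + 1 : ℕ) : ℚ) + 2 - t) * (2 * (1 / (3 + (mTr M B : ℚ))) + 1 / (2 + (mTr M B : ℚ))) -
        ((((q + 1 + 1 : ℕ) : ℚ) + 2) / (((q + 1 + 1 : ℕ) : ℚ) + 1)) *
          (2 * (if M.eRk ((τ \ B : Finset α) : Set α) + 1 + 1 ≤ (t : ℕ∞) then (0 : ℚ) else 1) + dem M τ t B)) =
      ∑ B ∈ Rq M τ q, ((((q + 1 + 1 : ℕ) : ℚ) + 2 - t) * (1 / (3 + (mTr M B : ℚ))) -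
        ((((q + 1 + 1 : ℕ) : ℚ) + 2) / (((q + 1 + 1 : ℕ) : ℚ) + 1)) *
          (if M.eRk ((τ \ B : Finset α) : Set α) + 1 + 1 ≤ (t : ℕ∞) then (0 : ℚ) else 1)) +
      ∑ B ∈ Rq M τ q, ((((q + 1 + 1 : ℕ) : ℚ) + 2 - t) * (1 / (3 + (mTr M B : ℚ))) -
        ((((q + 1 + 1 : ℕ) : ℚ) + 2) / (((q + 1 + 1 : ℕ) : ℚ) + 1)) *
          (if M.eRk ((τ \ B : Finset α) : Set α) + 1 + 1 ≤ (t : ℕ∞) then (0 : ℚ) else 1)) +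
      ∑ B ∈ Rq M τ q, ((((q + 1 + 1 : ℕ) : ℚ) + 2 - t) * (1 / (2 + (mTr M B : ℚ))) -
        ((((q + 1 + 1 : ℕ) : ℚ) + 2) / (((q + 1 + 1 : ℕ) : ℚ) + 1)) * dem M τ t B) := by
    rw [← Finset.sum_add_distrib, ← Finset.sum_add_distrib]
    apply Finset.sum_congr rfl
    intro B _
    ring
  rw [e]
  linarith

/-- **The trace-layer «trace + two points» shape from the profile inequality of its trace.** -/
theorem traceSum_hyp_add_two_nonneg_of_profile (ha : a ∈ gr M) (ha' : a' ∈ gr M) (hne : a ≠ a') (haτ : a ∉ τ)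
    (ha'τ : a' ∉ τ) (hacl : a ∉ M.closure (τ : Set α)) (ha'cl : a' ∉ M.closure (τ : Set α))
    (hrτ : M.eRk (τ : Set α) = (q : ℕ∞)) (hrG : M.eRk ((insert a (insert a' τ) : Finset α) : Set α) = (q : ℕ∞) + 1)
    (hq : 1 ≤ q) (ht : t ≤ q + 2) (hP : 0 ≤ traceHypAddTwoProfile M τ a a' q t) :
    0 ≤ ∑ B ∈ Rq M (insert a (insert a' τ)) (q + 1),
        ((((q + 1 + 1 : ℕ) : ℚ) + 2 - t) * (1 / (2 + (mTr M B : ℚ))) -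
          ((((q + 1 + 1 : ℕ) : ℚ) + 2) / (((q + 1 + 1 : ℕ) : ℚ) + 1)) * dem M (insert a (insert a' τ)) t B) :=
  hP.trans (traceSum_hyp_add_two_ge_profile ha ha' hne haτ ha'τ hacl ha'cl hrτ hrG hq ht)

end TraceHypAddTwo

end PercRepro.GenQ
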